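import Summits.BirchSwinnertonDyer.BirchSwinnertonDyer.Theorems.PAdicOrderV2PAdicOrderThesisR2StubJetVisible
import Summits.BirchSwinnertonDyer.BirchSwinnertonDyer.Theorems.PAdicOrderV2PAdicOrderThesisR2StubPointShape
import Summits.BirchSwinnertonDyer.BirchSwinnertonDyer.Theorems.PAdicOrderV2PAdicOrderThesisR2StubJetAssembly
import Summits.BirchSwinnertonDyer.BirchSwinnertonDyer.Theorems.PAdicOrderV2PAdicOrderThesisR2StubSigmaJet
import Literature.NumberTheory.EllipticCurves.CanonicalPAdicHeightHolds
import Literature.NumberTheory.EllipticCurves.ComplexMultiplication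

/-!
# BirchSwinnertonDyer / PAdicOrderV2 — crux `PAdicOrderThesisR2` (stmt-0487), line `wieferich-jet`:
# the JET CONGRUENCE of the canonical cyclotomic `p`-adic height and the height-Wieferich criterion

Composition file of the line (lead seat a1, cycle 1): the four registered analytic stubs of the
skeleton `Cruxes/PAdicOrderThesisR2/Lines/wieferich_jet.lean` have landed
(`stub_pointShape` p143221, `stub_sigmaJet` p143282, `stub_jetAssembly` p143215,
`stub_jetVisible_of_not_heightWieferich` p143203), so the line's lever is now an unconditional
theorem of the tree:

* `jetCongruence` — **Mazur–Tate sigma jet congruence.** For `E/ℚ` (globally minimal `W`), a good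
  ordinary prime `p ≥ 5` and an ADMISSIBLE rational point `Q = (x, y)` (non-torsion, `‖x‖_p > 1`,
  sigma disc, non-singular reduction at every prime — Mazur–Stein–Tate 2006 §1), the canonical
  cyclotomic `p`-adic height `ĥ_p(Q) = log_p(den x) − 2 log_p σ_p(−x/y)` (Stein–Wuthrich 2013 §4.1
  (4.1), the tree's `WeierstrassCurve.canonicalPAdicHeight`) satisfies
  `‖ĥ_p(Q) − log_p(num x)‖_p ≤ p^{−v_p(den x)}`, i.e. writing `x = a/d²`:
  `ĥ_p(Q) ≡ log_p a (mod p^{v_p(d²)})`. The truncation `σ_p = t + (a₁/2)t² + O(t³)` is universal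
  (free of `E₂(E, ω)`), so the height is read modulo the square of the denominator by the Iwasawa
  logarithm of an INTEGER.
* `canonicalPAdicHeight_ne_zero_of_not_isHeightWieferich` — **the height-Wieferich criterion.**
  If moreover `a^{p−1} ≢ 1 (mod p^{v_p(d²)})` (the prime `p` is "not height-Wieferich" for `Q`:
  `¬ (a^{p−1} = 1 ∨ v_p(den x) ≤ v_p(a^{p−1} − 1))`), then `ĥ_p(Q) ≠ 0` — a certificate of
  non-vanishing of the canonical `p`-adic height by integer arithmetic alone (`‖log_p a‖ =
  ‖a^{p−1} − 1‖ > p^{−v_p(den x)} ≥ ‖ĥ_p(Q) − log_p a‖`).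
* `exists_isCanonical_and_pairing_self_ne_zero` — hence the canonical cyclotomic `p`-adic height
  PAIRING (`PAdicHeightData.IsCanonical`, which exists: `exists_isCanonical_holds`) does not vanish
  at `Q`: a weak-Schneider witness at `p` from a height-non-Wieferich admissible point.
* `onePrimeUBRankOne_of_heightNonWieferich` — the sector composition of the line, with its three
  remaining inputs as explicit hypotheses (each a registered/declared statement of the skeleton,
  none asserted here): (NW) a height-non-Wieferich admissible point at some good ordinary `p ≥ 5`
  on every curve with a point of infinite order (OPEN), Gross–Zagier–Kolyvagin `r_an = 1 ⇒ 1 ≤ r_MW`,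
  and Perrin-Riou's `p`-adic Gross–Zagier consequence over `ℚ` (`ĥ_p(Q) ≠ 0 ⇒ ord_T L_p(f, α_p) ≤ 1`
  in analytic rank one) — give the one-prime `p`-adic upper bound `ord_{T=0} L_p(f, α_p, T) ≤ r_an`
  in analytic rank one (child C3|_{r_an = 1} of the crux; = the ∃p-weakening of crux #5
  `PAdicOrderRankOneR4`, stmt-0515).

References: B. Mazur, W. Stein, J. Tate, Doc. Math. Extra Vol. Coates (2006), Thm. 1.3, §1, §4.1
(37a1 at `p = 5`); W. Stein, C. Wuthrich, Math. Comp. 82 (2013), §4.1 eq. (4.1); B. Perrin-Riou,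
Invent. Math. 89 (1987), Thm. 1.3.
-/

-- single-conjunct summit: `Summit.BirchSwinnertonDyer.BirchSwinnertonDyer.…` repeats the name by design
set_option linter.dupNamespace false

namespace Summit.BirchSwinnertonDyer.BirchSwinnertonDyer.Cruxes.PAdicOrderThesisR2.WieferichJet

open Literature.NumberTheory.EllipticCurves Literature.NumberTheory.EllipticCurves.ModularForms

/-- **The Mazur–Tate sigma jet congruence** (unconditional): for `W/ℚ` globally minimal elliptic,
`p ≥ 5` good ordinary and an admissible rational point `(x, y)`,
`‖ĥ_p(x, y) − log_p(num x)‖_p ≤ p^{−v_p(den x)}`. Composition of the landed stubs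
`stub_jetAssembly`, `stub_pointShape`, `stub_sigmaJet`.
[cite: MazurSteinTate2006, Thm. 1.3 and §4.1] -/
theorem jetCongruence :
    ∀ (W : WeierstrassCurve ℚ) [W.IsElliptic] [W.IsGloballyMinimal] (p : ℕ) [Fact p.Prime],
      5 ≤ p → IsOrdinaryAt W p →
      ∀ {x y : ℚ} (h : W.toAffine.Nonsingular x y), W.IsAdmissible p (.some x y h) →
        ‖W.canonicalPAdicHeight p (.some x y h) - padicLog p ((x.num : ℚ) : ℚ_[p])‖
          ≤ (p : ℝ) ^ (-(padicValNat p x.den : ℤ)) :=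
  stub_jetAssembly stub_pointShape stub_sigmaJet

/-- An admissible point has `p ∤ num x`: `‖x‖_p > 1` (`SatisfiesLocalConditions`) while
`p ∣ num x` would force `p ∤ den x` (coprimality) and hence `‖x‖_p ≤ 1` (`Padic.norm_rat_le_one`).
[folklore] -/
theorem not_dvd_num_of_isAdmissible {W : WeierstrassCurve ℚ} {p : ℕ} [Fact p.Prime] {x y : ℚ}
    (h : W.toAffine.Nonsingular x y) (hadm : W.IsAdmissible p (.some x y h)) :
    ¬ (p : ℤ) ∣ x.num := by
  intro hnum
  obtain ⟨hx, -, -⟩ : 1 < ‖((x : ℚ) : ℚ_[p])‖ ∧ _ ∧ _ := hadm.2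
  have hden : ¬ p ∣ x.den := by
    intro hden
    have h1 : p ∣ x.num.natAbs := Int.natCast_dvd.mp hnum
    have h2 : p ∣ Nat.gcd x.num.natAbs x.den := Nat.dvd_gcd h1 hden
    rw [x.reduced.gcd_eq_one] at h2
    exact (Fact.out : p.Prime).one_lt.ne' (Nat.dvd_one.mp h2)
  exact absurd hx (not_lt.mpr (Padic.norm_rat_le_one hden))

/-- **The height-Wieferich criterion** (unconditional): for `W/ℚ` globally minimal elliptic,
`p ≥ 5` good ordinary and an admissible rational point `(x, y)` which is NOT height-Wieferich at `p`
(`¬ (num x^{p−1} = 1 ∨ v_p(den x) ≤ v_p(num x^{p−1} − 1))`, pure integer arithmetic), the canonical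
cyclotomic `p`-adic height does not vanish: `ĥ_p(x, y) ≠ 0`. (Jet congruence + the isometry
`‖log_p a‖ = ‖a^{p−1} − 1‖` of the Iwasawa logarithm on `p`-unit integers.)
[cite: MazurSteinTate2006, §4.1] -/
theorem canonicalPAdicHeight_ne_zero_of_not_isHeightWieferich (W : WeierstrassCurve ℚ) [W.IsElliptic]
    [W.IsGloballyMinimal] (p : ℕ) [Fact p.Prime] (h5 : 5 ≤ p) (hO : IsOrdinaryAt W p) {x y : ℚ}
    (h : W.toAffine.Nonsingular x y) (hadm : W.IsAdmissible p (.some x y h))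
    (hnw : ¬ (x.num ^ (p - 1) = 1 ∨
      (padicValNat p x.den : ℤ) ≤ padicValInt p (x.num ^ (p - 1) - 1))) :
    W.canonicalPAdicHeight p (.some x y h) ≠ 0 := by
  intro h0
  have hJ := jetCongruence W p h5 hO h hadm
  have hvis := stub_jetVisible_of_not_heightWieferich p (by omega) x
    (not_dvd_num_of_isAdmissible h hadm) hnw
  rw [h0, zero_sub, norm_neg] at hJ
  exact absurd hvis (not_lt.mpr hJ)

/-- **A weak-Schneider witness from a height-non-Wieferich point** (unconditional): under the same
hypotheses the canonical cyclotomic `p`-adic height PAIRING of `E` at `p` exists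
(`exists_isCanonical_holds`, Mazur–Stein–Tate 2006 Thm. 1.3 / Bernardi) and does not vanish at
`Q = (x, y)`: `⟨Q, Q⟩_p = ĥ_p(Q) ≠ 0`. [cite: MazurSteinTate2006, §1 and §4.1] -/
theorem exists_isCanonical_and_pairing_self_ne_zero (W : WeierstrassCurve ℚ) [W.IsElliptic]
    [W.IsGloballyMinimal] (p : ℕ) [Fact p.Prime] (h5 : 5 ≤ p) (hO : IsOrdinaryAt W p) {x y : ℚ}
    (h : W.toAffine.Nonsingular x y) (hadm : W.IsAdmissible p (.some x y h))
    (hnw : ¬ (x.num ^ (p - 1) = 1 ∨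
      (padicValNat p x.den : ℤ) ≤ padicValInt p (x.num ^ (p - 1) - 1))) :
    ∃ D : WeierstrassCurve.PAdicHeightData W p, D.IsCanonical ∧
      D.pairing (.some x y h) (.some x y h) ≠ 0 := by
  obtain ⟨D, hD⟩ := WeierstrassCurve.exists_isCanonical_holds W p h5 hO.1 hO.2
  refine ⟨D, hD, ?_⟩
  rw [hD _ hadm]
  exact canonicalPAdicHeight_ne_zero_of_not_isHeightWieferich W p h5 hO h hadm hnw

/-- A Weierstrass curve over `ℚ` with `1 ≤ r_MW` has a rational point of infinite order
(`mordellWeilRank = finrank ℤ E(ℚ)` with the classical decidability instance, bridged by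
`convert`; the tree's `exists_not_isOfFinAddOrder_of_one_le_finrank`). [folklore] -/
theorem exists_not_isOfFinAddOrder_of_one_le_mordellWeilRank (W : WeierstrassCurve ℚ)
    (hr : 1 ≤ W.mordellWeilRank) : ∃ P : W.toAffine.Point, ¬ IsOfFinAddOrder P := by
  have hr' : 1 ≤ Module.finrank ℤ W.toAffine.Point := by
    unfold WeierstrassCurve.mordellWeilRank at hr
    convert hr
  exact exists_not_isOfFinAddOrder_of_one_le_finrank hr'

/-- **Sector composition of line `wieferich-jet`** (the rank-one one-prime upper bound from its
three remaining inputs, all explicit hypotheses — nothing is asserted): (NW) every globally minimal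
elliptic curve with a point of infinite order has, at some good ordinary `p ≥ 5`, an admissible
point that is not height-Wieferich (OPEN; registered stub `stub_heightNonWieferich`);
(GZK) `r_an = 1 ⇒ 1 ≤ r_MW` (Gross–Zagier 1986 + Kolyvagin 1990; in stub `stub_factsInPrint`);
(PR) Perrin-Riou over `ℚ` at one prime: in analytic rank one an admissible point with `ĥ_p ≠ 0`
forces `ord_{T=0} L_p(f, α_p, T) ≤ 1` (Perrin-Riou 1987 Thm. 1.3 + GZK over a Heegner field; in
stub `stub_factsInPrint`). THEN every curve of analytic rank one has a good ordinary prime `p ≥ 5`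
with `ord_{T=0} L_p(f, α_p, T) ≤ r_an` for every newform `f` — by the height-Wieferich criterion
above. [cite: PerrinRiou1987, Thm. 1.3] -/
theorem onePrimeUBRankOne_of_heightNonWieferich
    (hNW : ∀ (W : WeierstrassCurve ℚ) [W.IsElliptic] [W.IsGloballyMinimal],
      (∃ P : W.toAffine.Point, ¬ IsOfFinAddOrder P) →
      ∃ (p : ℕ) (_ : Fact p.Prime), 5 ≤ p ∧ IsOrdinaryAt W p ∧
        ∃ (x y : ℚ) (h : W.toAffine.Nonsingular x y),
          W.IsAdmissible p (.some x y h) ∧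
          ¬ (x.num ^ (p - 1) = 1 ∨ (padicValNat p x.den : ℤ) ≤ padicValInt p (x.num ^ (p - 1) - 1)))
    (hLB : ∀ (W : WeierstrassCurve ℚ) [W.IsElliptic] [W.IsGloballyMinimal],
      W.analyticRank = 1 → 1 ≤ W.mordellWeilRank)
    (hPR : ∀ (W : WeierstrassCurve ℚ) [W.IsElliptic] [W.IsGloballyMinimal], W.analyticRank = 1 →
      ∀ (p : ℕ) [Fact p.Prime], 5 ≤ p → IsOrdinaryAt W p →
      ∀ {x y : ℚ} (h : W.toAffine.Nonsingular x y), W.IsAdmissible p (.some x y h) →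
        W.canonicalPAdicHeight p (.some x y h) ≠ 0 →
      ∀ {N : ℕ} [NeZero N] (f : CuspForm (CongruenceSubgroup.Gamma0 N) 2), IsNewformOf W f →
        (padicLFunction f (unitRoot W p : ℚ_[p])).order ≤ 1) :
    ∀ (W : WeierstrassCurve ℚ) [W.IsElliptic] [W.IsGloballyMinimal], W.analyticRank = 1 →
      ∃ (p : ℕ) (_ : Fact p.Prime), 5 ≤ p ∧ IsOrdinaryAt W p ∧
        ∀ {N : ℕ} [NeZero N] (f : CuspForm (CongruenceSubgroup.Gamma0 N) 2), IsNewformOf W f →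
          (padicLFunction f (unitRoot W p : ℚ_[p])).order ≤ (W.analyticRank : ℕ∞) := by
  intro W _ _ hr
  obtain ⟨p, hp, h5, hO, x, y, h, hadm, hnw⟩ :=
    hNW W (exists_not_isOfFinAddOrder_of_one_le_mordellWeilRank W (hLB W hr))
  refine ⟨p, hp, h5, hO, fun f hf ↦ ?_⟩
  rw [hr, Nat.cast_one]
  exact hPR W hr p h5 hO h hadm
    (canonicalPAdicHeight_ne_zero_of_not_isHeightWieferich W p h5 hO h hadm hnw) f hf

end Summit.BirchSwinnertonDyer.BirchSwinnertonDyer.Cruxes.PAdicOrderThesisR2.WieferichJet
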